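import Mathlib
import HarnessLib
import Literature.Analysis.FluidPDE.SuitableWeak
import Summits.NavierStokesRegularity.NavierStokesRegularity.Theorems.TypeIQuarterGateSliceBudgetDefs

/-!
# Line `slice_budget` on crux `TypeIQuarterGate.ScarEnvelopeTypeI` (stmt-NavierStokesRegularity-23843) —
# THE NULL TABLE and THE DIAGONAL: what the Type-I vertex bounds already force about the slice-octave cube

Helper for the deciding stub SD = `SliceBudget.stub_sliceOctaveBudget`
(`CruxHypotheses ν T u p → TameOutside T u → OctaveBudget ν T u`) of the line `slice_budget`
(owner ns-idea-7, critic idea-crit-7), landed `--supports 23843` on DIRECTOR-NS #186 (1)(a) / KEY-NS #108 (3)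
by the instrument seat nsreg-p3 (cell `pub/ns-regularity-ideate`, memo `ns-regularity-ideate-p3/round-28/ROUND-28.md`).
NOTHING here narrows the crux or proves SD: these are the elementary inequalities («null table», L1–L4) and the
reduction of a FAILURE of SD to the intermediate diagonal (S5) that the memo and the instrument
`slicebudget28/1.0` quote BY NAME.  Over the line's own `SliceBudget.SingularPt` / `SliceBudget.OctaveBudget`
(`TypeIQuarterGateSliceBudgetDefs`) and the Literature quantities `parabolicCylinder`, `cknA`, `IsTypeIBlowup`.

* (L1) `rate_vertex_shift`, `typeIRate_on_cylinder`, `typeIRate_ae_on_cylinder`: a pointwise Type-I rate read from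
  the clock of `T` is a rate, with the same constant, on every backward parabolic cylinder with vertex time `≤ T`
  — the hypothesis shape `hI` of `Literature.Analysis.FluidPDE.scaledEnergies_bounded_of_typeIRate` at a shifted
  vertex.
* (L2) `chebyshev_sq_restrict`: `λ² · μ|ₛ {λ ≤ f} ≤ ∫_s f²` — the saturated set of an annulus has volume
  `≤ (slice energy)/λ²` (the Chebyshev-extremal configuration is the filament enemy of SD).
* (L3) `cube_le_sup_mul_energy`: `∫_s f³ ≤ c ∫_s f²` when `f ≤ c` on `s` (the kinematic ceiling: sup × slice-L²);
  (L3′) `cube_level_split`: `∫_s f³ ≤ λ ∫_s f² + c ∫_{s ∩ {λ<f}} f²` — SD can fail at an octave only through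
  energy at super-`λ` velocity levels (the intermittency form of SD).
* (L4) `freezing`, `freezing'`, `freezing_octave`: along a curve with speed `≤ C₀/√(T−σ)` the displacement on
  `[t,s]`, `s < T`, is `≤ 2C₀(√(T−t) − √(T−σ)) ≤ 2C₀√(T−t)`; at `|x − a| = e^j √(T−t)`, `j > 1 + log 2C₀`, that is
  less than `e⁻¹` of the radius — far octaves are kinematically frozen until `T`.
* (S1) `nearCeiling_of_rate_of_slice`: the Type-I rate `‖u t x‖ ≤ C/√(T−t)` near `T` and the vertex slice bound
  `cknA r (T,a) u ≤ K_A` (`0 < r < r₂`) at the singular points give the NEAR CEILING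
  `m(ℓ,t) ≤ K ℓ/√(T−t)` for `√(ν(T−t)) ≤ ℓ ≤ r₁` (`m` = `octaveCube`, SD's integrand verbatim).
* (S5) `singularPt_mem_scars`, `exists_isolating_radius`, `outer_bound`, **`sd_fails_only_on_the_diagonal`**
  (+ `_tendsto`, `_of_typeI`): with finitely many scars (the last conjunct of `ScarZoom.CruxHypotheses` for a
  given finite `σ`, spelled out as a hypothesis) and the near ceiling, `¬ OctaveBudget ν T u` forces a singular point
  `a ∈ σ` and `t_k → T`, `ℓ_k → 0⁺` with `ℓ_k/√(ν(T−t_k)) → ∞` and `m(ℓ_k,t_k) → ∞`: the fixed outer scales are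
  closed by a finite subcover of the compact shell by tame balls, the near octaves by (S1); SD can fail only on
  the diagonal `ℓ → 0`, `ℓ/√(T−t) → ∞`.

No proposition is DEFINED here (the one definition, `octaveCube`, is the `ℝ≥0∞`-valued annular cube = SD's
integrand verbatim) and no statement about the crux, its route `TypeIQuarterGate` (`closes` consumes
`QuarterLawTypeI`, `QuarterZoom`, `ParabolicGaldiLiouville`) or the summit is proved here.  hard core evaded: none.

LANDING NOTE.  Author: instrument seat nsreg-p3 g24 (cell `pub/ns-regularity-ideate`, tree-ready file
`round-28/TypeIQuarterGateScarEnvelopeTypeISliceBudgetNullTable.lean` sha16 ae5a6735b18f6355 = plates `Null28.lean`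
c95cef85bcbfdce0 + `Diagonal28.lean` bd8264fe8f43b25a, evidence #14 on stmt-23843); landed VERBATIM by the prover
hand ns-in-wu-con g2 (DIRECTOR-NS #204 (3) / inputs-15; `perm.theorems-prover-only` for the author), split in two
files only for the 400-line rule: THIS part 1/2 = (L1)–(L4), `octaveCube`, `singularPt_mem_scars`,
`exists_isolating_radius`, `outer_bound`; part 2/2 = `…SliceBudgetNullTableDiagonal.lean` ((S5), (S1)).
-/

noncomputable section

-- the summit-side namespace repeats a component by design (single-conjunct summit, D-0017).
set_option linter.dupNamespace false

namespace Summit.NavierStokesRegularity.NavierStokesRegularity.Cruxes.ScarEnvelopeTypeI.SliceBudget.NullTable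

open MeasureTheory Set Metric Filter Topology
open scoped ENNReal NNReal
open Literature.Analysis.FluidPDE

/-! ## (L1) the Type-I rate at a shifted vertex -/

/-- A rate with respect to the clock of `T` is a rate with respect to every earlier clock `t' ≤ T`. -/
theorem rate_vertex_shift {T t' s y c : ℝ} (ht' : t' ≤ T) (hy : 0 ≤ y)
    (h : Real.sqrt (T - s) * y ≤ c) : Real.sqrt (t' - s) * y ≤ c :=
  le_trans (mul_le_mul_of_nonneg_right (Real.sqrt_le_sqrt (by linarith)) hy) h

/-- The hypothesis `hI` of `scaledEnergies_bounded_of_typeIRate` at ANY vertex `z` with `z.1 ≤ T` whose cylinder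
starts after `t₀`, from a pointwise Type-I rate on the time slab `(t₀, T)`. -/
theorem typeIRate_on_cylinder {E : Type*} [NormedAddCommGroup E] [InnerProductSpace ℝ E]
    (u : ℝ → E → E) {T t₀ c : ℝ}
    (hrate : ∀ s, t₀ < s → s < T → ∀ x, Real.sqrt (T - s) * ‖u s x‖ ≤ c)
    (z : ℝ × E) (r : ℝ) (hzT : z.1 ≤ T) (hr : t₀ ≤ z.1 - r ^ 2) :
    ∀ w ∈ parabolicCylinder r z, Real.sqrt (z.1 - w.1) * ‖u w.1 w.2‖ ≤ c := by
  intro w hw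
  rcases hw with ⟨⟨h1, h2⟩, _⟩
  exact rate_vertex_shift hzT (norm_nonneg _) (hrate w.1 (by linarith) (by linarith) w.2)

/-- The almost-everywhere form actually consumed by `scaledEnergies_bounded_of_typeIRate`. -/
theorem typeIRate_ae_on_cylinder {E : Type*} [NormedAddCommGroup E] [InnerProductSpace ℝ E]
    [MeasurableSpace E] (μ : Measure (ℝ × E))
    (u : ℝ → E → E) {T t₀ c : ℝ}
    (hrate : ∀ s, t₀ < s → s < T → ∀ x, Real.sqrt (T - s) * ‖u s x‖ ≤ c)
    (z : ℝ × E) (r : ℝ) (hzT : z.1 ≤ T) (hr : t₀ ≤ z.1 - r ^ 2)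
    (hmeas : MeasurableSet (parabolicCylinder r z)) :
    ∃ c' : ℝ, ∀ᵐ w ∂(μ.restrict (parabolicCylinder r z)), Real.sqrt (z.1 - w.1) * ‖u w.1 w.2‖ ≤ c' :=
  ⟨c, (ae_restrict_iff' hmeas).2 (Filter.Eventually.of_forall
    (typeIRate_on_cylinder u hrate z r hzT hr))⟩

/-! ## (L2) Chebyshev sparsity of the saturated set -/

/-- `λ² · μ|ₛ{λ ≤ f} ≤ ∫_s f²`. -/
theorem chebyshev_sq_restrict {α : Type*} [MeasurableSpace α] (μ : Measure α) (s : Set α)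
    (f : α → ℝ≥0∞) (hf : AEMeasurable f (μ.restrict s)) (lam : ℝ≥0∞) :
    lam ^ 2 * μ.restrict s {x | lam ≤ f x} ≤ ∫⁻ x in s, f x ^ 2 ∂μ := by
  have hsub : {x | lam ≤ f x} ⊆ {x | lam ^ 2 ≤ f x ^ 2} := by
    intro x hx
    simp only [Set.mem_setOf_eq] at hx ⊢
    gcongr
  calc lam ^ 2 * μ.restrict s {x | lam ≤ f x}
      ≤ lam ^ 2 * μ.restrict s {x | lam ^ 2 ≤ f x ^ 2} := by gcongr
    _ ≤ ∫⁻ x in s, f x ^ 2 ∂μ := mul_meas_ge_le_lintegral₀ (hf.pow_const 2) (lam ^ 2)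

/-! ## (L3) kinematic ceiling and (L3′) level split -/

/-- `∫_s f³ ≤ c · ∫_s f²` when `f ≤ c < ∞` on `s`. -/
theorem cube_le_sup_mul_energy {α : Type*} [MeasurableSpace α] (μ : Measure α) {s : Set α}
    (hs : MeasurableSet s) (f : α → ℝ≥0∞) {c : ℝ≥0∞} (hc : c ≠ ∞) (hfc : ∀ x ∈ s, f x ≤ c) :
    ∫⁻ x in s, f x ^ 3 ∂μ ≤ c * ∫⁻ x in s, f x ^ 2 ∂μ := by
  calc ∫⁻ x in s, f x ^ 3 ∂μ ≤ ∫⁻ x in s, c * f x ^ 2 ∂μ := by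
        apply setLIntegral_mono' hs
        intro x hx
        calc f x ^ 3 = f x * f x ^ 2 := by ring
          _ ≤ c * f x ^ 2 := by gcongr; exact hfc x hx
    _ = c * ∫⁻ x in s, f x ^ 2 ∂μ := lintegral_const_mul' c _ hc

/-- `∫_s f³ ≤ λ ∫_s f² + c ∫_{ {λ < f} ∩ s} f²` when `f ≤ c < ∞` on `s`: the cube lives on the super-`λ` set. -/
theorem cube_level_split {α : Type*} [MeasurableSpace α] (μ : Measure α) {s : Set α}
    (hs : MeasurableSet s) {f : α → ℝ≥0∞} (hf : Measurable f) {c lam : ℝ≥0∞} (hc : c ≠ ∞) (hlam : lam ≠ ∞)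
    (hfc : ∀ x ∈ s, f x ≤ c) :
    ∫⁻ x in s, f x ^ 3 ∂μ
      ≤ lam * ∫⁻ x in s, f x ^ 2 ∂μ + c * ∫⁻ x in ({x | lam < f x} ∩ s), f x ^ 2 ∂μ := by
  have hT : MeasurableSet {x | lam < f x} := measurableSet_lt measurable_const hf
  have hpt : ∀ x ∈ s, f x ^ 3 ≤ lam * f x ^ 2 + {x | lam < f x}.indicator (fun x => c * f x ^ 2) x := by
    intro x hx
    by_cases h : lam < f x
    · have : {x | lam < f x}.indicator (fun x => c * f x ^ 2) x = c * f x ^ 2 := by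
        simp [Set.indicator_of_mem, h]
      rw [this]
      calc f x ^ 3 = f x * f x ^ 2 := by ring
        _ ≤ c * f x ^ 2 := by gcongr; exact hfc x hx
        _ ≤ lam * f x ^ 2 + c * f x ^ 2 := le_add_self
    · have hle : f x ≤ lam := not_lt.1 h
      have : {x | lam < f x}.indicator (fun x => c * f x ^ 2) x = 0 := by
        simp [Set.indicator_of_notMem, h]
      rw [this, add_zero]
      calc f x ^ 3 = f x * f x ^ 2 := by ring
        _ ≤ lam * f x ^ 2 := by gcongr
  calc ∫⁻ x in s, f x ^ 3 ∂μ
      ≤ ∫⁻ x in s, (lam * f x ^ 2 + {x | lam < f x}.indicator (fun x => c * f x ^ 2) x) ∂μ :=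
        setLIntegral_mono' hs hpt
    _ = ∫⁻ x in s, lam * f x ^ 2 ∂μ + ∫⁻ x in s, {x | lam < f x}.indicator (fun x => c * f x ^ 2) x ∂μ := by
        rw [lintegral_add_left ((hf.pow_const 2).const_mul lam)]
    _ = lam * ∫⁻ x in s, f x ^ 2 ∂μ + c * ∫⁻ x in ({x | lam < f x} ∩ s), f x ^ 2 ∂μ := by
        rw [lintegral_const_mul' lam _ hlam, lintegral_indicator hT, Measure.restrict_restrict hT,
          lintegral_const_mul' c _ hc]

/-! ## (L4) kinematic freezing under the Type-I rate -/

/-- Along a curve `X` with speed `‖X'‖ ≤ C₀/√(T−σ)` on `[t, s)`, `s < T`: displacement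
`‖X σ − X t‖ ≤ 2 C₀ √(T−t) − 2 C₀ √(T−σ)` on `[t, s]`. -/
theorem freezing {E : Type*} [NormedAddCommGroup E] [NormedSpace ℝ E] {X V : ℝ → E} {t s T C₀ : ℝ}
    (hsT : s < T)
    (hX : ContinuousOn X (Icc t s)) (hV : ∀ σ ∈ Ico t s, HasDerivWithinAt X (V σ) (Ici σ) σ)
    (hrate : ∀ σ ∈ Ico t s, ‖V σ‖ ≤ C₀ / Real.sqrt (T - σ)) :
    ∀ σ ∈ Icc t s, ‖X σ - X t‖ ≤ 2 * C₀ * Real.sqrt (T - t) - 2 * C₀ * Real.sqrt (T - σ) := by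
  have key := image_norm_le_of_norm_deriv_right_le_deriv_boundary'
    (f := fun σ => X σ - X t) (f' := V) (a := t) (b := s)
    (B := fun σ => 2 * C₀ * Real.sqrt (T - t) - 2 * C₀ * Real.sqrt (T - σ))
    (B' := fun σ => C₀ / Real.sqrt (T - σ))
    (hX.sub continuousOn_const)
    (fun σ hσ => (hV σ hσ).sub_const (X t))
    (by simp)
    (by
      apply Continuous.continuousOn
      fun_prop)
    (by
      intro σ hσ
      have hpos : 0 < T - σ := by linarith [hσ.2]
      have h1 : HasDerivAt (fun σ' => Real.sqrt (T - σ')) ((-1) / (2 * Real.sqrt (T - σ))) σ := by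
        have := ((hasDerivAt_id σ).const_sub T).sqrt hpos.ne'
        simpa using this
      have h2 := (h1.const_mul (2 * C₀)).const_sub (2 * C₀ * Real.sqrt (T - t))
      have hsq : Real.sqrt (T - σ) ≠ 0 := (Real.sqrt_pos.2 hpos).ne'
      refine (h2.hasDerivWithinAt).congr_deriv ?_
      field_simp)
    (fun σ hσ => hrate σ hσ)
  intro σ hσ
  simpa using key hσ

/-- Freezing in the form used by the memo: displacement `≤ 2 C₀ √(T − t)` on `[t, s]`, `s < T`, `0 ≤ C₀`. -/
theorem freezing' {E : Type*} [NormedAddCommGroup E] [NormedSpace ℝ E] {X V : ℝ → E} {t s T C₀ : ℝ}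
    (hsT : s < T) (hC : 0 ≤ C₀)
    (hX : ContinuousOn X (Icc t s)) (hV : ∀ σ ∈ Ico t s, HasDerivWithinAt X (V σ) (Ici σ) σ)
    (hrate : ∀ σ ∈ Ico t s, ‖V σ‖ ≤ C₀ / Real.sqrt (T - σ)) :
    ∀ σ ∈ Icc t s, ‖X σ - X t‖ ≤ 2 * C₀ * Real.sqrt (T - t) := by
  intro σ hσ
  have h := freezing hsT hX hV hrate σ hσ
  have : 0 ≤ 2 * C₀ * Real.sqrt (T - σ) := by positivity
  linarith

/-- Octave bookkeeping of the freezing bound: at `|x − a| = e^j √(T−t)` the displacement `2C₀√(T−t)` is the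
fraction `2 C₀ e^{−j}` of the radius, `< e⁻¹` (stays inside its octave) as soon as `j > 1 + log (2 C₀)`. -/
theorem freezing_octave {C₀ j : ℝ} (hC : 0 < C₀) (hj : 1 + Real.log (2 * C₀) < j) :
    2 * C₀ * Real.exp (-j) < Real.exp (-1) := by
  have h1 : Real.log (2 * C₀) < j - 1 := by linarith
  have h2 : 2 * C₀ < Real.exp (j - 1) := by
    calc 2 * C₀ = Real.exp (Real.log (2 * C₀)) := (Real.exp_log (by positivity)).symm
      _ < Real.exp (j - 1) := Real.exp_lt_exp.2 h1
  have h3 : Real.exp (j - 1) * Real.exp (-j) = Real.exp (-1) := by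
    rw [← Real.exp_add]; ring_nf
  calc 2 * C₀ * Real.exp (-j) < Real.exp (j - 1) * Real.exp (-j) := by
        gcongr
    _ = Real.exp (-1) := h3

/-! ## (S5) SD fails only on the diagonal; (S1) the near ceiling -/

/-- The octave cube `m(ℓ,t) = ∫_{ℓ<|y−a|<eℓ} |u(t,y)|³ dy` — the integrand of `OctaveBudget`, verbatim. -/
noncomputable def octaveCube (u : ℝ → (EuclideanSpace ℝ (Fin 3)) → (EuclideanSpace ℝ (Fin 3))) (a : (EuclideanSpace ℝ (Fin 3))) (ℓ t : ℝ) : ℝ≥0∞ :=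
  ∫⁻ y in {y : (EuclideanSpace ℝ (Fin 3)) | ℓ < ‖y - a‖ ∧ ‖y - a‖ < Real.exp 1 * ℓ}, ‖u t y‖ₑ ^ (3 : ℝ)

/-!
Two hypothesis SHAPES recur below (spelled out in every signature; no proposition is defined here):

* the FINITE-SCAR clause of `ScarZoom.CruxHypotheses` (its last conjunct) for a given finite set `σ` («TameOff σ»):
  `∀ x ∉ σ, ∃ r > 0, ∃ A, ∀ t ∈ Ico (T − r²) T, ∀ y ∈ ball x r, ‖u t y‖ ≤ A`;
* the NEAR CEILING at the singular points (memo S1, «NearCeiling»; a consequence of the Type-I rate and the vertex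
  slice-energy bound, `nearCeiling_of_rate_of_slice`): `∀ a, SingularPt T u a → ∃ K δ₁ r₁ > 0, ∀ t ∈ Ioo (T−δ₁) T,
  ∀ ℓ, √(ν(T−t)) ≤ ℓ → ℓ ≤ r₁ → m(ℓ,t) ≤ K ℓ/√(T−t)`.
-/

/-! ## A singular point is a scar -/

/-- A singular point `a` (of `SingularPt T u`) lies in every finite scar set `σ` off which `u` is locally bounded up
to `T` (the finite-scar clause): otherwise the local bound near `a` contradicts singularity. (Docstring added at
landing — the author's file had none here; declaration text unchanged.) -/
theorem singularPt_mem_scars {T : ℝ} (hT : 0 < T) {u : ℝ → (EuclideanSpace ℝ (Fin 3)) → (EuclideanSpace ℝ (Fin 3))} {σ : Finset (EuclideanSpace ℝ (Fin 3))}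
    (hσ : ∀ x ∉ σ, ∃ r : ℝ, 0 < r ∧ ∃ A : ℝ,
      ∀ t ∈ Set.Ico (T - r ^ 2) T, ∀ y ∈ Metric.ball x r, ‖u t y‖ ≤ A)
    {a : (EuclideanSpace ℝ (Fin 3))} (ha : SingularPt T u a) : a ∈ σ := by
  by_contra hna
  obtain ⟨r, hr, A, hA⟩ := hσ a hna
  set r' : ℝ := min r (Real.sqrt T) with hr'
  have hr'pos : 0 < r' := lt_min hr (Real.sqrt_pos.2 hT)
  have hr'T : r' ^ 2 ≤ T := by
    have h1 : r' ≤ Real.sqrt T := min_le_right _ _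
    have h2 : r' ^ 2 ≤ Real.sqrt T ^ 2 := by
      exact pow_le_pow_left₀ hr'pos.le h1 2
    simpa [Real.sq_sqrt hT.le] using h2
  obtain ⟨t, ht, y, hy, hAy⟩ := ha r' hr'pos hr'T A
  have hrr : r' ≤ r := min_le_left _ _
  have ht' : t ∈ Set.Ico (T - r ^ 2) T := by
    refine ⟨?_, ht.2⟩
    have : r' ^ 2 ≤ r ^ 2 := pow_le_pow_left₀ hr'pos.le hrr 2
    linarith [ht.1]
  have hy' : y ∈ Metric.ball a r := Metric.ball_subset_ball hrr hy
  exact (lt_irrefl A) (lt_of_lt_of_le hAy (hA t ht' y hy'))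

/-! ## The outer end: fixed scales are bounded near `T` by the scar clause and compactness -/

/-- A positive radius `ρ₀` such that the closed ball of radius `e ρ₀` about `a` meets `σ` at most in `a`. -/
theorem exists_isolating_radius (σ : Finset (EuclideanSpace ℝ (Fin 3))) (a : (EuclideanSpace ℝ (Fin 3))) :
    ∃ ρ₀ : ℝ, 0 < ρ₀ ∧ ∀ b ∈ σ, b ≠ a → Real.exp 1 * ρ₀ < dist b a := by
  classical
  set S : Finset ℝ := insert 1 ((σ.filter (fun b => b ≠ a)).image
    (fun b => dist b a / (2 * Real.exp 1))) with hS
  have hne : S.Nonempty := Finset.insert_nonempty _ _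
  refine ⟨S.min' hne, ?_, ?_⟩
  · apply (Finset.lt_min'_iff S hne).2
    intro y hy
    rcases Finset.mem_insert.1 hy with rfl | hy
    · norm_num
    · obtain ⟨b, hb, rfl⟩ := Finset.mem_image.1 hy
      have hba : b ≠ a := (Finset.mem_filter.1 hb).2
      have : 0 < dist b a := dist_pos.2 hba
      positivity
  · intro b hb hba
    have hmem : dist b a / (2 * Real.exp 1) ∈ S := by
      apply Finset.mem_insert_of_mem
      exact Finset.mem_image.2 ⟨b, Finset.mem_filter.2 ⟨hb, hba⟩, rfl⟩
    have hle : S.min' hne ≤ dist b a / (2 * Real.exp 1) := Finset.min'_le S _ hmem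
    have hd : 0 < dist b a := dist_pos.2 hba
    have he : 0 < Real.exp 1 := Real.exp_pos 1
    calc Real.exp 1 * S.min' hne ≤ Real.exp 1 * (dist b a / (2 * Real.exp 1)) := by gcongr
      _ = dist b a / 2 := by field_simp
      _ < dist b a := by linarith

/-- OUTER BOUND.  Under the scar clause, for `a : (EuclideanSpace ℝ (Fin 3))` with isolating radius `ρ₀` and every `ℓ_* > 0` there
are `M < ∞` and `δ > 0` with `m(ℓ,t) ≤ M` for all `t ∈ (T−δ, T)` and `ℓ_* ≤ ℓ ≤ ρ₀`. -/
theorem outer_bound {T : ℝ} {u : ℝ → (EuclideanSpace ℝ (Fin 3)) → (EuclideanSpace ℝ (Fin 3))} {σ : Finset (EuclideanSpace ℝ (Fin 3))}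
    (hσ : ∀ x ∉ σ, ∃ r : ℝ, 0 < r ∧ ∃ A : ℝ,
      ∀ t ∈ Set.Ico (T - r ^ 2) T, ∀ y ∈ Metric.ball x r, ‖u t y‖ ≤ A)
    (a : (EuclideanSpace ℝ (Fin 3)))
    {ρ₀ : ℝ} (hiso : ∀ b ∈ σ, b ≠ a → Real.exp 1 * ρ₀ < dist b a)
    {ℓs : ℝ} (hℓs : 0 < ℓs) :
    ∃ M : ℝ, ∃ δ : ℝ, 0 < δ ∧ ∀ t ∈ Set.Ioo (T - δ) T, ∀ ℓ : ℝ, ℓs ≤ ℓ → ℓ ≤ ρ₀ →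
      octaveCube u a ℓ t ≤ ENNReal.ofReal M := by
  classical
  -- the compact shell
  set Sh : Set (EuclideanSpace ℝ (Fin 3)) := Metric.closedBall a (Real.exp 1 * ρ₀) \ Metric.ball a ℓs with hSh
  have hShc : IsCompact Sh := (isCompact_closedBall a _).diff Metric.isOpen_ball
  -- points of the shell are not scars
  have hnot : ∀ y ∈ Sh, y ∉ σ := by
    intro y hy hyσ
    have hy1 : dist y a ≤ Real.exp 1 * ρ₀ := Metric.mem_closedBall.1 hy.1
    have hy2 : ¬ dist y a < ℓs := fun h => hy.2 (Metric.mem_ball.2 h)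
    by_cases hya : y = a
    · subst hya; simp at hy2; linarith
    · have := hiso y hyσ hya
      linarith
  -- tame radius / bound at every point off σ (junk values on σ)
  have hch : ∀ y : (EuclideanSpace ℝ (Fin 3)), ∃ r : ℝ, ∃ A : ℝ, y ∉ σ → (0 < r ∧
      ∀ t ∈ Set.Ico (T - r ^ 2) T, ∀ z ∈ Metric.ball y r, ‖u t z‖ ≤ A) := by
    intro y
    by_cases hy : y ∈ σ
    · exact ⟨1, 0, fun h => (h hy).elim⟩
    · obtain ⟨r, hr, A, hA⟩ := hσ y hy
      exact ⟨r, A, fun _ => ⟨hr, hA⟩⟩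
  choose rad bnd hspec using hch
  -- finite subcover of the shell by the tame balls
  have hcover : Sh ⊆ ⋃ y ∈ Sh, Metric.ball y (rad y) := by
    intro y hy
    refine Set.mem_iUnion₂.2 ⟨y, hy, Metric.mem_ball_self ((hspec y (hnot y hy)).1)⟩
  obtain ⟨I, hISh, hIfin, hIcov⟩ :=
    hShc.elim_finite_subcover_image (fun y _ => Metric.isOpen_ball) hcover
  -- uniform bound and time window
  set Astar : ℝ := ∑ y ∈ hIfin.toFinset, |bnd y| with hAstar
  set D : Finset ℝ := insert 1 (hIfin.toFinset.image (fun y => rad y ^ 2)) with hD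
  have hDne : D.Nonempty := Finset.insert_nonempty _ _
  set δ : ℝ := D.min' hDne with hδ
  have hδpos : 0 < δ := by
    apply (Finset.lt_min'_iff D hDne).2
    intro x hx
    rcases Finset.mem_insert.1 hx with rfl | hx
    · norm_num
    · obtain ⟨y, hy, rfl⟩ := Finset.mem_image.1 hx
      have hyI : y ∈ I := hIfin.mem_toFinset.1 hy
      exact pow_pos (hspec y (hnot y (hISh hyI))).1 2
  have hδle : ∀ y ∈ I, δ ≤ rad y ^ 2 := by
    intro y hyI
    apply Finset.min'_le
    apply Finset.mem_insert_of_mem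
    exact Finset.mem_image.2 ⟨y, hIfin.mem_toFinset.2 hyI, rfl⟩
  have hAle : ∀ y ∈ I, bnd y ≤ Astar := by
    intro y hyI
    have h1 : |bnd y| ≤ Astar := by
      rw [hAstar]
      exact Finset.single_le_sum (f := fun y => |bnd y|) (fun _ _ => abs_nonneg _)
        (hIfin.mem_toFinset.2 hyI)
    exact (le_abs_self _).trans h1
  -- the pointwise bound on the shell for t ∈ (T-δ, T)
  have hpt : ∀ t ∈ Set.Ioo (T - δ) T, ∀ z ∈ Sh, ‖u t z‖ ≤ Astar := by
    intro t ht z hz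
    obtain ⟨y, hyI, hzy⟩ : ∃ y ∈ I, z ∈ Metric.ball y (rad y) := by
      have := hIcov hz
      simpa only [Set.mem_iUnion, exists_prop] using this
    have hsp := (hspec y (hnot y (hISh hyI))).2
    have ht' : t ∈ Set.Ico (T - rad y ^ 2) T := ⟨by linarith [ht.1, hδle y hyI], ht.2⟩
    exact (hsp t ht' z hzy).trans (hAle y hyI)
  -- the bound M
  have hvol : volume (Metric.closedBall a (Real.exp 1 * ρ₀)) < ⊤ :=
    (ProperSpace.isCompact_closedBall a _).measure_lt_top
  set C : ℝ≥0∞ := ENNReal.ofReal Astar ^ (3 : ℝ) with hC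
  have hCtop : C ≠ ⊤ := by
    rw [hC]; exact ENNReal.rpow_ne_top_of_nonneg (by norm_num) ENNReal.ofReal_ne_top
  refine ⟨(C * volume (Metric.closedBall a (Real.exp 1 * ρ₀))).toReal, δ, hδpos, ?_⟩
  intro t ht ℓ hℓ1 hℓ2
  rw [ENNReal.ofReal_toReal (ENNReal.mul_ne_top hCtop hvol.ne)]
  have hsub : {y : (EuclideanSpace ℝ (Fin 3)) | ℓ < ‖y - a‖ ∧ ‖y - a‖ < Real.exp 1 * ℓ} ⊆ Sh := by
    intro y hy
    rcases hy with ⟨h1, h2⟩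
    constructor
    · rw [Metric.mem_closedBall, dist_eq_norm]
      have : Real.exp 1 * ℓ ≤ Real.exp 1 * ρ₀ := by
        have he : 0 < Real.exp 1 := Real.exp_pos 1
        nlinarith
      linarith
    · rw [Metric.mem_ball, dist_eq_norm, not_lt]
      linarith
  have hShm : MeasurableSet Sh := measurableSet_closedBall.diff measurableSet_ball
  calc octaveCube u a ℓ t
      ≤ ∫⁻ y in Sh, ‖u t y‖ₑ ^ (3 : ℝ) := lintegral_mono_set hsub
    _ ≤ ∫⁻ y in Sh, C := by
        apply setLIntegral_mono' hShm
        intro y hy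
        rw [hC]
        apply ENNReal.rpow_le_rpow _ (by norm_num)
        rw [← ofReal_norm]
        exact ENNReal.ofReal_le_ofReal (hpt t ht y hy)
    _ = C * volume Sh := setLIntegral_const Sh C
    _ ≤ C * volume (Metric.closedBall a (Real.exp 1 * ρ₀)) := by
        gcongr
        exact fun y hy => hy.1


end Summit.NavierStokesRegularity.NavierStokesRegularity.Cruxes.ScarEnvelopeTypeI.SliceBudget.NullTable

end
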